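import Summits.Ventures.CertifiedManyBodySolver.Observables.LocalPairCeiling
import HarnessLib

/-!
# The quadrature LID of a singlet pair: `±(P + Pᴴ) ≤ 2√ν` — an abstract two-mode sum of squares

HONEST FRAMING: a certificate-free OPERATOR INEQUALITY (every state of every Hamiltonian, every volume);
objects and exact identities only, consumed by `LocalPairKinematicLid.lean` (the `√2`-lid of the `d`-wave
pair amplitude `Re ω(P₀^d)`); nothing here speaks of order, a field, `h → 0`, `T_c` or superconductivity.
Cell hubbard-cq (rung CQ; row «h-chord transport nodes», seat hubbard-cq-obsth-2 g23, 2026-08-29),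
executing the lead's RULING 428 (C) OFFER with the sum-of-squares certificate of anomaly-1 g32
(`hubbard-pc-lens-anomaly-1/g32/kin/SQRT2-LID-CERT.md`); companion of `SingletPairAlgebra.lean`
(`2 − B⋆B = T⋆T + 2R⋆R`) and `LocalPairCeiling.lean` (`P†P ≤ 2ν`).

## The certificate (no spectral theory)

For two CAR modes `x, y` put `s = x y + (x y)⋆` (the pair quadrature), `n = x⋆x`, `N = y⋆y`. In ANY
`*`-ring (`SingletPair.two_mul_one_sub_quadrature_eq` / `SingletPair.two_mul_one_add_quadrature_eq`):

`2·(1 ∓ s) = (1 ∓ s)⋆(1 ∓ s) + ((1 − N) n)⋆((1 − N) n) + (N (1 − n))⋆(N (1 − n))`,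

so `−1 ≤ s ≤ 1` in every `*`-representation (proof: CAR normal ordering, then `noncomm_ring`). For the
singlet pair `B = a_{x↑} b_↓ − a_{x↓} b_↑` of four CAR modes, `B + B⋆ = s(a_{x↑}, b_↓) − s(a_{x↓}, b_↑)`, hence
`−2 ≤ B + B⋆ ≤ 2`. A site–bond-mode pair `P = a_{x↑} ψ_↓ − a_{x↓} ψ_↑`, `ψ_σ = Σ_{e ∈ S} c_e a_{(v e)σ}`
(`v` injective on `S`, `v e ≠ x`) is `P = √ν · B` with `ν = Σ_e ‖c_e‖²` after normalising `ψ_σ` (exactly as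
in `LocalPairCeiling.lean`, whose smeared-mode CAR lemmas are reused), so `±(P + Pᴴ) ≤ 2√ν · 1`:
**`SingletPair.posSemidef_smul_one_sub_sitePair_add_conjTranspose`** and **`…_add_sitePair_…`**
(the lower side = the upper side for the weights `−c`).

SHARP (not proved here): `spec(s/2) = {−1, −½, 0, ½, 1}`-type, `±1` attained on the two-mode singlet.
No definition; no named fact; no `sorry`. References: D. J. Scalapino, Phys. Rep. 250 (1995) 329, §2
eq. (2.2)–(2.4) (the pair operators); O. Bratteli, D. W. Robinson, *Operator Algebras and Quantum
Statistical Mechanics II*, §5.2.2 (CAR); folklore otherwise.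
-/

namespace Summit.Ventures.CertifiedManyBodySolver.Observables

open Matrix Literature.MathematicalPhysics.QuantumLattice Literature.Probability.LatticeModels
open scoped ComplexOrder ComplexConjugate

namespace SingletPair

/-! ### §1 The two-mode quadrature sum of squares (abstract `*`-ring) -/

section Abstract

variable {A : Type*} [Ring A] [StarRing A]

/-- **Two-mode quadrature sum of squares (upper side).** In any `*`-ring, two CAR modes `x, y`
(`x² = y² = 0`, `{x, y} = {x, y⋆} = 0`, `{x, x⋆} = {y, y⋆} = 1`) satisfy, for the pair quadrature
`s = x y + (x y)⋆`, `2·(1 − s) = (1 − s)⋆(1 − s) + Z₁⋆Z₁ + Z₂⋆Z₂` with `Z₁ = (1 − y⋆y)·x⋆x`,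
`Z₂ = y⋆y·(1 − x⋆x)`; hence `s ≤ 1` in every `*`-representation. Bratteli–Robinson II §5.2.2 (CAR
normal ordering). [folklore] -/
theorem two_mul_one_sub_quadrature_eq (x y : A)
    (hx : x * x = 0) (hy : y * y = 0) (hxy : x * y + y * x = 0)
    (hxys : x * star y + star y * x = 0)
    (hcx : x * star x + star x * x = 1) (hcy : y * star y + star y * y = 1) :
    2 * (1 - (x * y + star (x * y))) =
      star (1 - (x * y + star (x * y))) * (1 - (x * y + star (x * y))) +
        star ((1 - star y * y) * (star x * x)) * ((1 - star y * y) * (star x * x)) +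
        star (star y * y * (1 - star x * x)) * (star y * y * (1 - star x * x)) := by
  -- oriented normal-ordering rules (creators to the left; `x` before `y`)
  have sy : star y * star y = 0 := by rw [← star_mul, hy, star_zero]
  have ryx : y * x = -(x * y) := eq_neg_of_add_eq_zero_right hxy
  have rsysx : star y * star x = -(star x * star y) := by
    have h := congrArg star hxy
    rw [star_add, star_mul, star_mul, star_zero] at h
    exact eq_neg_of_add_eq_zero_left h
  have rxsy : x * star y = -(star y * x) := eq_neg_of_add_eq_zero_left hxys
  have rysx : y * star x = -(star x * y) := by
    have h := congrArg star hxys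
    simp only [star_add, star_mul, star_star, star_zero] at h
    exact eq_neg_of_add_eq_zero_left h
  have rcx : x * star x = 1 - star x * x := eq_sub_of_add_eq hcx
  have rcy : y * star y = 1 - star y * y := eq_sub_of_add_eq hcy
  have hx' : ∀ w : A, x * (x * w) = 0 := fun w => by rw [← mul_assoc, hx, zero_mul]
  have ryx' : ∀ w : A, y * (x * w) = -(x * (y * w)) := fun w => by
    rw [← mul_assoc, ryx, neg_mul, mul_assoc]
  have rsysx' : ∀ w : A, star y * (star x * w) = -(star x * (star y * w)) := fun w => by
    rw [← mul_assoc, rsysx, neg_mul, mul_assoc]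
  have rxsy' : ∀ w : A, x * (star y * w) = -(star y * (x * w)) := fun w => by
    rw [← mul_assoc, rxsy, neg_mul, mul_assoc]
  have rysx' : ∀ w : A, y * (star x * w) = -(star x * (y * w)) := fun w => by
    rw [← mul_assoc, rysx, neg_mul, mul_assoc]
  have rcx' : ∀ w : A, x * (star x * w) = w - star x * (x * w) := fun w => by
    rw [← mul_assoc, rcx, sub_mul, one_mul, mul_assoc]
  have rcy' : ∀ w : A, y * (star y * w) = w - star y * (y * w) := fun w => by
    rw [← mul_assoc, rcy, sub_mul, one_mul, mul_assoc]
  rw [two_mul]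
  simp only [star_mul, star_sub, star_add, star_neg, star_one, star_star, mul_add, add_mul, mul_sub,
    sub_mul, mul_one, one_mul, mul_zero, mul_assoc, neg_mul, mul_neg, neg_neg, neg_zero, sub_zero,
    add_zero, zero_add, hx, hy, sy, hx', ryx, ryx', rsysx, rsysx', rxsy', rysx', rcx, rcx', rcy, rcy']
  noncomm_ring

/-- **Two-mode quadrature sum of squares (lower side)**: with the same `Z₁, Z₂`,
`2·(1 + s) = (1 + s)⋆(1 + s) + Z₁⋆Z₁ + Z₂⋆Z₂`; hence `−1 ≤ s`. Bratteli–Robinson II §5.2.2. [folklore] -/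
theorem two_mul_one_add_quadrature_eq (x y : A)
    (hx : x * x = 0) (hy : y * y = 0) (hxy : x * y + y * x = 0)
    (hxys : x * star y + star y * x = 0)
    (hcx : x * star x + star x * x = 1) (hcy : y * star y + star y * y = 1) :
    2 * (1 + (x * y + star (x * y))) =
      star (1 + (x * y + star (x * y))) * (1 + (x * y + star (x * y))) +
        star ((1 - star y * y) * (star x * x)) * ((1 - star y * y) * (star x * x)) +
        star (star y * y * (1 - star x * x)) * (star y * y * (1 - star x * x)) := by
  have sy : star y * star y = 0 := by rw [← star_mul, hy, star_zero]
  have ryx : y * x = -(x * y) := eq_neg_of_add_eq_zero_right hxy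
  have rsysx : star y * star x = -(star x * star y) := by
    have h := congrArg star hxy
    rw [star_add, star_mul, star_mul, star_zero] at h
    exact eq_neg_of_add_eq_zero_left h
  have rxsy : x * star y = -(star y * x) := eq_neg_of_add_eq_zero_left hxys
  have rysx : y * star x = -(star x * y) := by
    have h := congrArg star hxys
    simp only [star_add, star_mul, star_star, star_zero] at h
    exact eq_neg_of_add_eq_zero_left h
  have rcx : x * star x = 1 - star x * x := eq_sub_of_add_eq hcx
  have rcy : y * star y = 1 - star y * y := eq_sub_of_add_eq hcy
  have hx' : ∀ w : A, x * (x * w) = 0 := fun w => by rw [← mul_assoc, hx, zero_mul]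
  have ryx' : ∀ w : A, y * (x * w) = -(x * (y * w)) := fun w => by
    rw [← mul_assoc, ryx, neg_mul, mul_assoc]
  have rsysx' : ∀ w : A, star y * (star x * w) = -(star x * (star y * w)) := fun w => by
    rw [← mul_assoc, rsysx, neg_mul, mul_assoc]
  have rxsy' : ∀ w : A, x * (star y * w) = -(star y * (x * w)) := fun w => by
    rw [← mul_assoc, rxsy, neg_mul, mul_assoc]
  have rysx' : ∀ w : A, y * (star x * w) = -(star x * (y * w)) := fun w => by
    rw [← mul_assoc, rysx, neg_mul, mul_assoc]
  have rcx' : ∀ w : A, x * (star x * w) = w - star x * (x * w) := fun w => by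
    rw [← mul_assoc, rcx, sub_mul, one_mul, mul_assoc]
  have rcy' : ∀ w : A, y * (star y * w) = w - star y * (y * w) := fun w => by
    rw [← mul_assoc, rcy, sub_mul, one_mul, mul_assoc]
  rw [two_mul]
  simp only [star_mul, star_sub, star_add, star_neg, star_one, star_star, mul_add, add_mul, mul_sub,
    sub_mul, mul_one, one_mul, mul_zero, mul_assoc, neg_mul, mul_neg, neg_neg, neg_zero, sub_zero,
    add_zero, zero_add, hx, hy, sy, hx', ryx, ryx', rsysx, rsysx', rxsy', rysx', rcx, rcx', rcy, rcy']
  noncomm_ring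

end Abstract

/-! ### §2 The singlet pair between a site and a bond mode: `±(P + Pᴴ) ≤ 2√ν` -/

section SitePair

variable {Λ : Type*} [LinearOrder Λ] [Fintype Λ]

/-- **The quadrature LID of a site–bond-mode singlet pair (upper side).** For a site `x`, sites `v e`
(`e ∈ S`, `v` injective on `S`, `v e ≠ x`) and weights `c e`, the singlet pair
`P = a_{x↑} ψ_↓ − a_{x↓} ψ_↑`, `ψ_σ = Σ_{e ∈ S} c_e a_{(v e)σ}`, satisfies `P + Pᴴ ≤ 2√ν · 1`,
`ν = Σ_e ‖c_e‖²` (the difference is positive semidefinite): after normalising `ψ_σ` the two pairs of modes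
`(a_{x↑}, b_↓)`, `(a_{x↓}, b_↑)` satisfy the CAR and §1 applies to each. Scalapino, Phys. Rep. 250 (1995)
329, §2; Bratteli–Robinson II §5.2.2. [folklore] -/
theorem posSemidef_smul_one_sub_sitePair_add_conjTranspose {E : Type*} (S : Finset E) (c : E → ℂ)
    (v : E → Λ) (x : Λ) (hv : Set.InjOn v S) (hx : ∀ e ∈ S, v e ≠ x) :
    ((((2 : ℝ) * Real.sqrt (∑ e ∈ S, ‖c e‖ ^ 2) : ℝ) : ℂ) • (1 : Matrix (Finset (Orb Λ)) (Finset (Orb Λ)) ℂ) -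
      ((annihilation (orb x 0) * (∑ e ∈ S, c e • annihilation (orb (v e) 1)) -
          annihilation (orb x 1) * (∑ e ∈ S, c e • annihilation (orb (v e) 0))) +
        (annihilation (orb x 0) * (∑ e ∈ S, c e • annihilation (orb (v e) 1)) -
          annihilation (orb x 1) * (∑ e ∈ S, c e • annihilation (orb (v e) 0)))ᴴ)).PosSemidef := by
  have hν0 : 0 ≤ ∑ e ∈ S, ‖c e‖ ^ 2 := Finset.sum_nonneg fun _ _ => by positivity
  set ν : ℝ := ∑ e ∈ S, ‖c e‖ ^ 2
  set a0 : Matrix (Finset (Orb Λ)) (Finset (Orb Λ)) ℂ := annihilation (orb x 0)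
  set a1 : Matrix (Finset (Orb Λ)) (Finset (Orb Λ)) ℂ := annihilation (orb x 1)
  set ψ0 : Matrix (Finset (Orb Λ)) (Finset (Orb Λ)) ℂ := ∑ e ∈ S, c e • annihilation (orb (v e) 0)
  set ψ1 : Matrix (Finset (Orb Λ)) (Finset (Orb Λ)) ℂ := ∑ e ∈ S, c e • annihilation (orb (v e) 1)
  have hinj : ∀ σ : Fin 2, Set.InjOn (fun e => orb (v e) σ) S := fun σ e he e' he' h =>
    hv he he' (orb_eq_orb_iff.1 h).1
  have hoff : ∀ σ τ : Fin 2, ∀ e ∈ S, orb (v e) σ ≠ orb x τ := fun σ τ e he h =>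
    hx e he (orb_eq_orb_iff.1 h).1
  -- the degenerate case `c = 0` on `S`
  by_cases hzero : ν = 0
  · have hc : ∀ e ∈ S, c e = 0 := fun e he => norm_eq_zero.1 (pow_eq_zero_iff two_ne_zero |>.1
      ((Finset.sum_eq_zero_iff_of_nonneg fun e _ => by positivity).1 hzero e he))
    have hψ0z : ψ0 = 0 := Finset.sum_eq_zero fun e he => by rw [hc e he, zero_smul]
    have hψ1z : ψ1 = 0 := Finset.sum_eq_zero fun e he => by rw [hc e he, zero_smul]
    rw [hψ0z, hψ1z, Matrix.mul_zero, Matrix.mul_zero, sub_zero, Matrix.conjTranspose_zero, add_zero,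
      sub_zero, hzero, Real.sqrt_zero, mul_zero, Complex.ofReal_zero, zero_smul]
    exact Matrix.PosSemidef.zero
  have hsqrt : Real.sqrt ν ≠ 0 := Real.sqrt_ne_zero'.2 (lt_of_le_of_ne hν0 (Ne.symm hzero))
  -- normalised bond modes
  set r : ℝ := (Real.sqrt ν)⁻¹ with hr
  set b0 : Matrix (Finset (Orb Λ)) (Finset (Orb Λ)) ℂ := (r : ℂ) • ψ0 with hb0
  set b1 : Matrix (Finset (Orb Λ)) (Finset (Orb Λ)) ℂ := (r : ℂ) • ψ1 with hb1
  have hrr : ((r : ℂ) * star (r : ℂ)) * (ν : ℂ) = 1 := by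
    rw [Complex.star_def, Complex.conj_ofReal, ← Complex.ofReal_mul, ← Complex.ofReal_mul, hr,
      ← mul_inv, Real.mul_self_sqrt hν0, inv_mul_cancel₀ hzero, Complex.ofReal_one]
  have santi : ∀ {X Y : Matrix (Finset (Orb Λ)) (Finset (Orb Λ)) ℂ} (a b : ℂ),
      X * Y + Y * X = 0 → (a • X) * (b • Y) + (b • Y) * (a • X) = 0 := by
    intro X Y a b h
    rw [Matrix.smul_mul, Matrix.mul_smul, smul_smul, Matrix.smul_mul, Matrix.mul_smul, smul_smul,
      mul_comm b a, ← smul_add, h, smul_zero]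
  have santi₁ : ∀ {X Y : Matrix (Finset (Orb Λ)) (Finset (Orb Λ)) ℂ} (b : ℂ),
      X * Y + Y * X = 0 → X * (b • Y) + (b • Y) * X = 0 := by
    intro X Y b h
    rw [Matrix.mul_smul, Matrix.smul_mul, ← smul_add, h, smul_zero]
  have smix : ∀ {X Y Z : Matrix (Finset (Orb Λ)) (Finset (Orb Λ)) ℂ} (a b : ℂ),
      X * Yᴴ + Yᴴ * X = Z → (a • X) * (b • Y)ᴴ + (b • Y)ᴴ * (a • X) = (a * star b) • Z := by
    intro X Y Z a b h
    rw [Matrix.conjTranspose_smul, Matrix.smul_mul, Matrix.mul_smul, smul_smul, Matrix.smul_mul,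
      Matrix.mul_smul, smul_smul, mul_comm (star b) a, ← smul_add, h]
  have smix₁ : ∀ {X Y : Matrix (Finset (Orb Λ)) (Finset (Orb Λ)) ℂ} (b : ℂ),
      X * Yᴴ + Yᴴ * X = 0 → X * (b • Y)ᴴ + (b • Y)ᴴ * X = 0 := by
    intro X Y b h
    rw [Matrix.conjTranspose_smul, Matrix.mul_smul, Matrix.smul_mul, ← smul_add, h, smul_zero]
  -- the twelve CAR relations of the two mode pairs `(a0, b1)` and `(a1, b0)`
  have p03 : a0 * b1 + b1 * a0 = 0 := santi₁ _ (annihilation_anticomm_sum S c _ _)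
  have p12 : a1 * b0 + b0 * a1 = 0 := santi₁ _ (annihilation_anticomm_sum S c _ _)
  have z0 : a0 * a0 = 0 := mul_self_eq_zero_of_anticomm (annihilation_anticommute_holds _ _)
  have z1 : a1 * a1 = 0 := mul_self_eq_zero_of_anticomm (annihilation_anticommute_holds _ _)
  have z2 : b0 * b0 = 0 := mul_self_eq_zero_of_anticomm (santi _ _ (sum_anticomm_sum S c _ S c _))
  have z3 : b1 * b1 = 0 := mul_self_eq_zero_of_anticomm (santi _ _ (sum_anticomm_sum S c _ S c _))
  have d0 : a0 * star a0 + star a0 * a0 = 1 := by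
    have h := annihilation_mul_creation_add_creation_mul_annihilation_holds (orb x (0 : Fin 2)) (orb x 0)
    rwa [if_pos rfl] at h
  have d1 : a1 * star a1 + star a1 * a1 = 1 := by
    have h := annihilation_mul_creation_add_creation_mul_annihilation_holds (orb x (1 : Fin 2)) (orb x 1)
    rwa [if_pos rfl] at h
  have d2 : b0 * star b0 + star b0 * b0 = 1 := by
    rw [← one_smul ℂ (1 : Matrix (Finset (Orb Λ)) (Finset (Orb Λ)) ℂ), ← hrr, ← smul_smul]
    exact smix (r : ℂ) (r : ℂ) (sum_mixed_self S c (fun e => orb (v e) 0) (hinj 0))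
  have d3 : b1 * star b1 + star b1 * b1 = 1 := by
    rw [← one_smul ℂ (1 : Matrix (Finset (Orb Λ)) (Finset (Orb Λ)) ℂ), ← hrr, ← smul_smul]
    exact smix (r : ℂ) (r : ℂ) (sum_mixed_self S c (fun e => orb (v e) 1) (hinj 1))
  have m03 : a0 * star b1 + star b1 * a0 = 0 :=
    smix₁ _ (annihilation_mixed_sum S c (fun e => orb (v e) 1) (orb x 0) (hoff 1 0))
  have m12 : a1 * star b0 + star b0 * a1 = 0 :=
    smix₁ _ (annihilation_mixed_sum S c (fun e => orb (v e) 0) (orb x 1) (hoff 0 1))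
  -- the two abstract sums of squares
  have key₁ := two_mul_one_sub_quadrature_eq a0 b1 z0 z3 p03 m03 d0 d3
  have key₂ := two_mul_one_add_quadrature_eq a1 b0 z1 z2 p12 m12 d1 d2
  simp only [Matrix.star_eq_conjTranspose] at key₁ key₂
  have hpsd₁ : (2 * (1 - (a0 * b1 + (a0 * b1)ᴴ))).PosSemidef := by
    rw [key₁]
    exact ((Matrix.posSemidef_conjTranspose_mul_self _).add
      (Matrix.posSemidef_conjTranspose_mul_self _)).add (Matrix.posSemidef_conjTranspose_mul_self _)
  have hpsd₂ : (2 * (1 + (a1 * b0 + (a1 * b0)ᴴ))).PosSemidef := by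
    rw [key₂]
    exact ((Matrix.posSemidef_conjTranspose_mul_self _).add
      (Matrix.posSemidef_conjTranspose_mul_self _)).add (Matrix.posSemidef_conjTranspose_mul_self _)
  -- `2·(2 − (B + Bᴴ)) = 2(1 − s↓) + 2(1 + s↑)` for `B = a0 b1 − a1 b0`
  have htwo : (2 : Matrix (Finset (Orb Λ)) (Finset (Orb Λ)) ℂ) =
      (2 : ℂ) • (1 : Matrix (Finset (Orb Λ)) (Finset (Orb Λ)) ℂ) := by
    rw [← Algebra.algebraMap_eq_smul_one, map_ofNat]
  have hsum : (2 : ℂ) • ((2 : ℂ) • (1 : Matrix (Finset (Orb Λ)) (Finset (Orb Λ)) ℂ) -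
      ((a0 * b1 - a1 * b0) + (a0 * b1 - a1 * b0)ᴴ)) =
        2 * (1 - (a0 * b1 + (a0 * b1)ᴴ)) + 2 * (1 + (a1 * b0 + (a1 * b0)ᴴ)) := by
    rw [htwo, Matrix.smul_mul, Matrix.smul_mul, one_mul, one_mul, ← smul_add, Matrix.conjTranspose_sub]
    congr 1
    rw [two_smul]
    abel
  have hB : ((2 : ℂ) • (1 : Matrix (Finset (Orb Λ)) (Finset (Orb Λ)) ℂ) -
      ((a0 * b1 - a1 * b0) + (a0 * b1 - a1 * b0)ᴴ)).PosSemidef := by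
    have h2 : ((2 : ℂ) • ((2 : ℂ) • (1 : Matrix (Finset (Orb Λ)) (Finset (Orb Λ)) ℂ) -
        ((a0 * b1 - a1 * b0) + (a0 * b1 - a1 * b0)ᴴ))).PosSemidef := by
      rw [hsum]; exact hpsd₁.add hpsd₂
    have h := h2.smul (show (0 : ℂ) ≤ 2⁻¹ by rw [Complex.le_def]; simp)
    rwa [smul_smul, inv_mul_cancel₀ two_ne_zero, one_smul] at h
  -- undo the normalisation: `P = √ν • B`
  have hsr : ((Real.sqrt ν : ℝ) : ℂ) * (r : ℂ) = 1 := by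
    rw [← Complex.ofReal_mul, hr, mul_inv_cancel₀ hsqrt, Complex.ofReal_one]
  have hψ0' : ψ0 = ((Real.sqrt ν : ℝ) : ℂ) • b0 := by rw [hb0, smul_smul, hsr, one_smul]
  have hψ1' : ψ1 = ((Real.sqrt ν : ℝ) : ℂ) • b1 := by rw [hb1, smul_smul, hsr, one_smul]
  have hP : a0 * ψ1 - a1 * ψ0 = ((Real.sqrt ν : ℝ) : ℂ) • (a0 * b1 - a1 * b0) := by
    rw [smul_sub, ← Matrix.mul_smul, ← Matrix.mul_smul, ← hψ0', ← hψ1']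
  have hPP : (a0 * ψ1 - a1 * ψ0) + (a0 * ψ1 - a1 * ψ0)ᴴ =
      ((Real.sqrt ν : ℝ) : ℂ) • ((a0 * b1 - a1 * b0) + (a0 * b1 - a1 * b0)ᴴ) := by
    rw [hP, Matrix.conjTranspose_smul, Complex.star_def, Complex.conj_ofReal, smul_add]
  have hgoal : ((((2 : ℝ) * Real.sqrt ν : ℝ)) : ℂ) • (1 : Matrix (Finset (Orb Λ)) (Finset (Orb Λ)) ℂ) -
      ((a0 * ψ1 - a1 * ψ0) + (a0 * ψ1 - a1 * ψ0)ᴴ) =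
        ((Real.sqrt ν : ℝ) : ℂ) • (((2 : ℂ) • (1 : Matrix (Finset (Orb Λ)) (Finset (Orb Λ)) ℂ) -
          ((a0 * b1 - a1 * b0) + (a0 * b1 - a1 * b0)ᴴ))) := by
    rw [hPP, smul_sub, smul_smul, Complex.ofReal_mul, Complex.ofReal_ofNat, mul_comm]
  rw [hgoal]
  exact hB.smul (Complex.zero_le_real.2 (Real.sqrt_nonneg ν))

/-- **The quadrature LID of a site–bond-mode singlet pair (lower side)**: with the same data,
`−(P + Pᴴ) ≤ 2√ν · 1` (apply the upper side to the weights `−c`, which flip the sign of `P`).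
Scalapino, Phys. Rep. 250 (1995) 329, §2. [folklore] -/
theorem posSemidef_smul_one_add_sitePair_add_conjTranspose {E : Type*} (S : Finset E) (c : E → ℂ)
    (v : E → Λ) (x : Λ) (hv : Set.InjOn v S) (hx : ∀ e ∈ S, v e ≠ x) :
    ((((2 : ℝ) * Real.sqrt (∑ e ∈ S, ‖c e‖ ^ 2) : ℝ) : ℂ) • (1 : Matrix (Finset (Orb Λ)) (Finset (Orb Λ)) ℂ) +
      ((annihilation (orb x 0) * (∑ e ∈ S, c e • annihilation (orb (v e) 1)) -
          annihilation (orb x 1) * (∑ e ∈ S, c e • annihilation (orb (v e) 0))) +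
        (annihilation (orb x 0) * (∑ e ∈ S, c e • annihilation (orb (v e) 1)) -
          annihilation (orb x 1) * (∑ e ∈ S, c e • annihilation (orb (v e) 0)))ᴴ)).PosSemidef := by
  have h := posSemidef_smul_one_sub_sitePair_add_conjTranspose S (fun e => -c e) v x hv hx
  have hneg : ∀ σ : Fin 2, (∑ e ∈ S, (-c e) • (annihilation (orb (v e) σ) :
      Matrix (Finset (Orb Λ)) (Finset (Orb Λ)) ℂ)) = -(∑ e ∈ S, c e • annihilation (orb (v e) σ)) := by
    intro σ
    rw [← Finset.sum_neg_distrib]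
    exact Finset.sum_congr rfl fun e _ => neg_smul _ _
  simp only [norm_neg, hneg, Matrix.mul_neg, sub_neg_eq_add, Matrix.conjTranspose_add,
    Matrix.conjTranspose_neg] at h
  convert h using 2
  rw [Matrix.conjTranspose_sub]
  abel

end SitePair

end SingletPair

end Summit.Ventures.CertifiedManyBodySolver.Observables
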